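/-
Copyright (c) 2026 the pub-hodgecm-mathlib formalisation cell (harness21).  Prover seat hodgecm-mathlib-B-p10 (g27), 2026-09-01.  Road «W′» = «R1LL-WILD»
((W′-B6) sub-socket (B6-V) «value laws on the torus», owner B-p14 (g33); brick (V-deep) shed 12:34:21Z): DEEP SHELL AVERAGES AGREE.
-/
import Literature.NumberTheory.Automorphic.UnitaryTwoDescentCongruenceDepth              -- ★ (this seat) FILE A: descent of a quotient, `ϖ^j`-congruence of quotients, depth in `U_w`
import Literature.NumberTheory.Rogawski1990.RankOneKappaShellAverageRenormalise        -- ★ p844282 B-p14 (g33): `prod_symm_conj_eq`, the `K × U(Φ₁)`-average currency (brings ★ p844070, `cmDatum`, `H_v`)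
import Literature.NumberTheory.Automorphic.DilationThickeningGL2                      -- ★ `exists_nhds_one_forall_conj_mem` (conjugation by a compact set is uniformly small)
import Literature.Topology.LocallyConstantCompactSupportUniform                        -- ★ F0P3-p01 (g13): `exists_nhds_one_forall_mul_eq_of_hasCompactSupport` (uniform right-smoothness)
import HarnessLib

/-!
# (V-deep) «DEEP SHELL AVERAGES AGREE»: past a depth `j = j(f, K, α)` the `K × U(Φ₁)_v`-average of a locally smooth `f` at an element of `U_w` only depends on its
# projective descent matrix modulo `ϖ^j`-congruence to `1` (Labesse–Langlands 1979 (2.2); Labesse 2024 Prop. 0.0.11 «on peut prendre ε = 0 si b est assez petit»)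

Topic `NumberTheory/Rogawski1990`; namespace `Literature.NumberTheory.Rogawski1990`.  THEOREMS ONLY (no definition, no named fact, no instance, no notation,
no `sorry`; net debt 0).  Cell `pub/hodgecm-mathlib`, F0∕P3a, crux H413 = `stmt-HodgeConjecture-24833`, line «N6nsGerm», residue «R1-CM-ram-wild», road «W′» =
«R1LL-WILD» (architect A-p16 (g28) RULINGS A-44∕A-46′∕A-47″); (W′-B6) contract v3 (F0P3-p01 (g14), 07fb81b8) binder `hdeep : m + j ≤ oT t → fbar m ↑t = fbar m (e ↑t)`
of (B6-V) (owner B-p14 (g33), census e5b7e346 §1 «deep»; interface 12:41:01Z).  Seat B-p10 (g27).  HONEST LABEL: HC_CM is proved only modulo the printed citations (2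
remaining named inputs hLiu418, h413) until rung 0 closes; nothing printed is asserted here.

THE MATHEMATICS.  `H_v = U(Φ₂)_v × U(Φ₁)_v`, `E₂ : U(Φ₂)_v ≃ U_w` the one-place model, `d = diag(1, α)` with `α` anti-fixed of either ramified type (`|α|_w ∈ {1, |ϖ_w|}`),
descent `d X d⁻¹ = ζ·ι_w(S)` (`S ∈ GL₂(L⁺_v)`).  For `f ∈ C_c^∞(H_v)` (`IsLocSmooth`) and `K ≤ U(Φ₂)_v` with `K × U(Φ₁)_v` compact open: `f` is UNIFORMLY right-smooth
(★ `exists_nhds_one_forall_mul_eq_of_hasCompactSupport`: `f(z·y) = f(z)` for all `z` once `y ∈ W`) and conjugation by the compact `K × U(Φ₁)_v` is uniformly small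
(★ `exists_nhds_one_forall_conj_mem`: `k⁻¹ y k ∈ W` for `y ∈ V`); if `X, X′` have descents with the SAME scalar then `d (X⁻¹X′) d⁻¹ = ι(S⁻¹S′)` (★ FILE A
`descent_inv_mul_eq_map`); `S ≡ 1 ≡ S′ (mod ϖ^j)` entrywise forces `S⁻¹S′ ≡ 1` (★ `forall_v_inv_mul_sub_one_le`), `ι_w` keeps the bound (★ `valued_toPlace`), the
`d`-twist costs at most `|α|⁻¹ ≤ q_w` (★ `forall_v_diagonal_twist_sub_one_le`); entrywise `exp(−j)`-balls shrink into every neighbourhood of `1 ∈ U_w` (★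
`exists_depth_mem_of_mem_nhds_one`); hence for `j` deep enough `(E₂⁻¹(X⁻¹X′), 1) ∈ V`, so `f(k⁻¹(E₂⁻¹X′, a)k) = f((k⁻¹(E₂⁻¹X, a)k)·(k⁻¹(E₂⁻¹(X⁻¹X′), 1)k)) =
f(k⁻¹(E₂⁻¹X, a)k)` for every `k ∈ K × U(Φ₁)_v`, and the two averages agree.  At the torus (`X, X′` = the shell-`m` elements of `↑t` and of its partner `e ↑t = Ad(D_u) ↑t`,
`S = S_m(β_t)` normalised to `a = 1`, `S′ = D_{u_F} S_m(β_t) D_{u_F}⁻¹`; (Ψ2) ★ p844005 `forall_v_shellConj_sub_smul_one_le` ∕ `forall_v_diagonal_conj_sub_smul_one_le` give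
both congruences from `m + j ≤ oT t`) this is LL79's «`f(a, b²v∕x; x, a+bu) = f(a₀, 0; x, a₀)` for `b` small» — for an ARBITRARY locally smooth `f`, no congruence
subgroup named, both dyadic types.

* **`exists_depth_setIntegral_conj_prod_eq_of_descent_congr`** (pair form), **`exists_depth_shellAverage_eq_of_descent_congr`** (the owner's `fbar` literal).

## References
* [LabesseLanglands1979] J.-P. Labesse, R. P. Langlands, *L-indistinguishability for SL(2)*, Canad. J. Math. 31 (1979) 726–785: §2 (2.1)–(2.2), pp. 8–9.
* [Labesse2024StabilisationGermesSL2] J.-P. Labesse, *Stabilisation et germes pour SL(2) en toutes caractéristiques*, arXiv:2411.14820: Prop. 0.0.11, Th. 0.0.12.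
* [Rogawski1990] J. D. Rogawski, *Automorphic Representations of Unitary Groups in Three Variables*, Ann. of Math. Stud. 123 (1990): §1.6 p. 6; §4.9 Lemma 4.9.3 p. 56.
-/

set_option autoImplicit false

noncomputable section

open scoped Matrix ValuativeRel MatrixGroups Topology WithZero
open Matrix ValuativeRel MeasureTheory NumberField IsDedekindDomain Filter Set

namespace Literature.NumberTheory.Rogawski1990

open Literature.NumberTheory.Automorphic Literature.NumberTheory.Automorphic.UnitaryGroup

/-! ## §5 The (V-deep) heads on `H_v = U(Φ₂)_v × U(Φ₁)_v` -/

section Deep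

variable (L : Type) [Field L] [NumberField L] [IsCMField L] (v : HeightOneSpectrum (𝓞 ↥(maximalRealSubfield L)))
  (w : PlacesOver L v) (hw : IsCMField.complexConj L • w.1 = w.1)
  [MeasurableSpace ((cmDatum L 2 (Matrix.of fun i j : Fin 2 => if i.val + j.val + 1 = 2 then (1 : L) else 0)).Local v × (cmDatum L 1 (Matrix.of fun i j : Fin 1 => if i.val + j.val + 1 = 1 then (1 : L) else 0)).Local v)]
  [BorelSpace ((cmDatum L 2 (Matrix.of fun i j : Fin 2 => if i.val + j.val + 1 = 2 then (1 : L) else 0)).Local v × (cmDatum L 1 (Matrix.of fun i j : Fin 1 => if i.val + j.val + 1 = 1 then (1 : L) else 0)).Local v)]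
  (ν : Measure ((cmDatum L 2 (Matrix.of fun i j : Fin 2 => if i.val + j.val + 1 = 2 then (1 : L) else 0)).Local v × (cmDatum L 1 (Matrix.of fun i j : Fin 1 => if i.val + j.val + 1 = 1 then (1 : L) else 0)).Local v))
  (f : ((cmDatum L 2 (Matrix.of fun i j : Fin 2 => if i.val + j.val + 1 = 2 then (1 : L) else 0)).Local v × (cmDatum L 1 (Matrix.of fun i j : Fin 1 => if i.val + j.val + 1 = 1 then (1 : L) else 0)).Local v) → ℂ) (hf : IsLocSmooth f)
  {α : w.1.adicCompletion L} (hα0 : α ≠ 0) (hvα : Valued.v α = 1 ∨ Valued.v α = WithZero.exp (-1 : ℤ))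
  (E₂ : (cmDatum L 2 (Matrix.of fun i j : Fin 2 => if i.val + j.val + 1 = 2 then (1 : L) else 0)).Local v ≃ₜ*
    ↥(unitaryGroupOfForm (galAdicCompletionMap (L := L) (IsCMField.complexConj L) hw) (placeForm (Matrix.of fun i j : Fin 2 => if i.val + j.val + 1 = 2 then (1 : L) else 0) w.1)))
  (K : Subgroup ((cmDatum L 2 (Matrix.of fun i j : Fin 2 => if i.val + j.val + 1 = 2 then (1 : L) else 0)).Local v))
  (hKo : IsOpen ((((K.prod (⊤ : Subgroup ((cmDatum L 1 (Matrix.of fun i j : Fin 1 => if i.val + j.val + 1 = 1 then (1 : L) else 0)).Local v))) :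
      Subgroup ((cmDatum L 2 (Matrix.of fun i j : Fin 2 => if i.val + j.val + 1 = 2 then (1 : L) else 0)).Local v ×
        (cmDatum L 1 (Matrix.of fun i j : Fin 1 => if i.val + j.val + 1 = 1 then (1 : L) else 0)).Local v))) :
    Set ((cmDatum L 2 (Matrix.of fun i j : Fin 2 => if i.val + j.val + 1 = 2 then (1 : L) else 0)).Local v ×
      (cmDatum L 1 (Matrix.of fun i j : Fin 1 => if i.val + j.val + 1 = 1 then (1 : L) else 0)).Local v)))
  (hKc : IsCompact ((((K.prod (⊤ : Subgroup ((cmDatum L 1 (Matrix.of fun i j : Fin 1 => if i.val + j.val + 1 = 1 then (1 : L) else 0)).Local v))) :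
      Subgroup ((cmDatum L 2 (Matrix.of fun i j : Fin 2 => if i.val + j.val + 1 = 2 then (1 : L) else 0)).Local v ×
        (cmDatum L 1 (Matrix.of fun i j : Fin 1 => if i.val + j.val + 1 = 1 then (1 : L) else 0)).Local v))) :
    Set ((cmDatum L 2 (Matrix.of fun i j : Fin 2 => if i.val + j.val + 1 = 2 then (1 : L) else 0)).Local v ×
      (cmDatum L 1 (Matrix.of fun i j : Fin 1 => if i.val + j.val + 1 = 1 then (1 : L) else 0)).Local v)))

include hf hα0 hvα hKo hKc in
/-- **(V-deep), PAIR FORM — PAST A DEPTH `j = j(f, K, α)` THE `K × U(Φ₁)_v`-AVERAGE ONLY SEES THE DESCENT MATRIX MODULO `ϖ^j`-CONGRUENCE TO `1`.**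
For `X, X′ ∈ U_w` with descents `d X d⁻¹ = ζ·ι(S)`, `d X′ d⁻¹ = ζ·ι(S′)` (`d = diag(1, α)`, `α` anti-fixed of either ramified type, SAME scalar `ζ`) and
`S ≡ 1 ≡ S′` entrywise modulo valuation `≤ exp(−j)`, the averages `∫_{K×U(Φ₁)} f(k⁻¹ (E₂⁻¹X, a) k)` and `∫_{K×U(Φ₁)} f(k⁻¹ (E₂⁻¹X′, a) k)` agree — Labesse–Langlands'
«`f(a, b²v∕x; x, a+bu) = f(a₀, 0; x, a₀)` for `b` small» ∕ Labesse «ε = 0 si `b` est assez petit», read on `U_w` for an ARBITRARY locally smooth `f` (uniform right-smoothness +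
compactness of `K × U(Φ₁)_v`; no congruence subgroup is named). [cite: LabesseLanglands1979, §2 (2.2) p. 9] [cite: Labesse2024StabilisationGermesSL2, Prop. 0.0.11]
[cite: Rogawski1990, §4.9 Lemma 4.9.3 p. 56] -/
theorem exists_depth_setIntegral_conj_prod_eq_of_descent_congr :
    ∃ j : ℕ, ∀ (X X' : ↥(unitaryGroupOfForm (galAdicCompletionMap (L := L) (IsCMField.complexConj L) hw) (placeForm (Matrix.of fun i j : Fin 2 => if i.val + j.val + 1 = 2 then (1 : L) else 0) w.1)))
      (ζ : w.1.adicCompletion L) (S S' : GL (Fin 2) (v.adicCompletion ↥(maximalRealSubfield L))),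
      Matrix.diagonal ![1, α] * ((X : GL (Fin 2) (w.1.adicCompletion L)) : Matrix (Fin 2) (Fin 2) (w.1.adicCompletion L)) * Matrix.diagonal ![1, α⁻¹] =
        ζ • (S : Matrix (Fin 2) (Fin 2) (v.adicCompletion ↥(maximalRealSubfield L))).map (toPlace v w) →
      Matrix.diagonal ![1, α] * ((X' : GL (Fin 2) (w.1.adicCompletion L)) : Matrix (Fin 2) (Fin 2) (w.1.adicCompletion L)) * Matrix.diagonal ![1, α⁻¹] =
        ζ • (S' : Matrix (Fin 2) (Fin 2) (v.adicCompletion ↥(maximalRealSubfield L))).map (toPlace v w) →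
      (∀ i k, Valued.v (((S : Matrix (Fin 2) (Fin 2) (v.adicCompletion ↥(maximalRealSubfield L))) - 1) i k) ≤ WithZero.exp (-(j : ℤ))) →
      (∀ i k, Valued.v (((S' : Matrix (Fin 2) (Fin 2) (v.adicCompletion ↥(maximalRealSubfield L))) - 1) i k) ≤ WithZero.exp (-(j : ℤ))) →
      ∀ a : (cmDatum L 1 (Matrix.of fun i j : Fin 1 => if i.val + j.val + 1 = 1 then (1 : L) else 0)).Local v,
        ∫ k in (((K.prod (⊤ : Subgroup ((cmDatum L 1 (Matrix.of fun i j : Fin 1 => if i.val + j.val + 1 = 1 then (1 : L) else 0)).Local v))) :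
            Subgroup ((cmDatum L 2 (Matrix.of fun i j : Fin 2 => if i.val + j.val + 1 = 2 then (1 : L) else 0)).Local v ×
              (cmDatum L 1 (Matrix.of fun i j : Fin 1 => if i.val + j.val + 1 = 1 then (1 : L) else 0)).Local v)) :
            Set ((cmDatum L 2 (Matrix.of fun i j : Fin 2 => if i.val + j.val + 1 = 2 then (1 : L) else 0)).Local v ×
              (cmDatum L 1 (Matrix.of fun i j : Fin 1 => if i.val + j.val + 1 = 1 then (1 : L) else 0)).Local v)), f (k⁻¹ * (E₂.symm X, a) * k) ∂ν =
        ∫ k in (((K.prod (⊤ : Subgroup ((cmDatum L 1 (Matrix.of fun i j : Fin 1 => if i.val + j.val + 1 = 1 then (1 : L) else 0)).Local v))) :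
            Subgroup ((cmDatum L 2 (Matrix.of fun i j : Fin 2 => if i.val + j.val + 1 = 2 then (1 : L) else 0)).Local v ×
              (cmDatum L 1 (Matrix.of fun i j : Fin 1 => if i.val + j.val + 1 = 1 then (1 : L) else 0)).Local v)) :
            Set ((cmDatum L 2 (Matrix.of fun i j : Fin 2 => if i.val + j.val + 1 = 2 then (1 : L) else 0)).Local v ×
              (cmDatum L 1 (Matrix.of fun i j : Fin 1 => if i.val + j.val + 1 = 1 then (1 : L) else 0)).Local v)), f (k⁻¹ * (E₂.symm X', a) * k) ∂ν := by
  -- (L1) uniform right-smoothness of `f`, uniform smallness of conjugation by the compact `K × U(Φ₁)_v`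
  obtain ⟨W, hW, hfW⟩ := Literature.Topology.exists_nhds_one_forall_mul_eq_of_hasCompactSupport hf.isLocallyConstant hf.hasCompactSupport
  obtain ⟨V, hV, hconj⟩ := exists_nhds_one_forall_conj_mem hKc hW
  -- pull `V` back to `U_w` along `Y ↦ (E₂⁻¹ Y, 1)`
  set ψ : ↥(unitaryGroupOfForm (galAdicCompletionMap (L := L) (IsCMField.complexConj L) hw) (placeForm (Matrix.of fun i j : Fin 2 => if i.val + j.val + 1 = 2 then (1 : L) else 0) w.1)) →
      ((cmDatum L 2 (Matrix.of fun i j : Fin 2 => if i.val + j.val + 1 = 2 then (1 : L) else 0)).Local v ×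
        (cmDatum L 1 (Matrix.of fun i j : Fin 1 => if i.val + j.val + 1 = 1 then (1 : L) else 0)).Local v) := fun Y => (E₂.symm Y, 1) with hψ
  have hψc : Continuous ψ := E₂.symm.continuous.prodMk continuous_const
  have hψ1 : ψ 1 = 1 := by simp only [hψ, map_one]; rfl
  have hV₁ : ψ ⁻¹' V ∈ 𝓝 (1 : ↥(unitaryGroupOfForm (galAdicCompletionMap (L := L) (IsCMField.complexConj L) hw) (placeForm (Matrix.of fun i j : Fin 2 => if i.val + j.val + 1 = 2 then (1 : L) else 0) w.1))) :=
    hψc.continuousAt.preimage_mem_nhds (by rw [hψ1]; exact hV)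
  -- (L3) the quantitative depth
  obtain ⟨j₀, hj₀⟩ := exists_depth_mem_of_mem_nhds_one L w.1 _ hV₁
  have hα1 : Valued.v α ≤ 1 := by
    rcases hvα with h | h
    · exact h.le
    · rw [h, ← WithZero.exp_zero, WithZero.exp_le_exp]; norm_num
  have hαinv : (Valued.v α)⁻¹ ≤ WithZero.exp (1 : ℤ) := by
    rcases hvα with h | h
    · rw [h, inv_one, ← WithZero.exp_zero, WithZero.exp_le_exp]; norm_num
    · rw [h, ← WithZero.exp_neg, neg_neg]
  have he0 : v.asIdeal.ramificationIdx' w.1.asIdeal ≠ 0 := by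
    haveI := PlacesOver.liesOver w
    exact Ideal.IsDedekindDomain.ramificationIdx'_ne_zero_of_liesOver w.1.asIdeal v.ne_bot
  -- transport of an `exp(−j)`-bound along `ι_w` and through the twist, for `j = j₀ + 1`
  have hι : ∀ (j : ℕ) (x : v.adicCompletion ↥(maximalRealSubfield L)), Valued.v x ≤ WithZero.exp (-(j : ℤ)) →
      Valued.v (toPlace v w x) ≤ WithZero.exp (-(j : ℤ)) := fun j x hx => by
    rw [valued_toPlace]
    have hx1 : Valued.v x ≤ 1 := hx.trans (by rw [← WithZero.exp_zero, WithZero.exp_le_exp]; omega)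
    exact (pow_le_of_le_one zero_le hx1 he0).trans hx
  refine ⟨j₀ + 1, fun X X' ζ S S' hX hX' hS hS' a => ?_⟩
  have hlt : WithZero.exp (-((j₀ + 1 : ℕ) : ℤ)) < 1 := by rw [← WithZero.exp_zero, WithZero.exp_lt_exp]; omega
  -- (L2) the quotient `Y := X⁻¹ X′` and its inverse are `exp(−j₀)`-close to `1`
  have hbound : ∀ (Y Y' : ↥(unitaryGroupOfForm (galAdicCompletionMap (L := L) (IsCMField.complexConj L) hw) (placeForm (Matrix.of fun i j : Fin 2 => if i.val + j.val + 1 = 2 then (1 : L) else 0) w.1)))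
      (T T' : GL (Fin 2) (v.adicCompletion ↥(maximalRealSubfield L))),
      Matrix.diagonal ![1, α] * ((Y : GL (Fin 2) (w.1.adicCompletion L)) : Matrix (Fin 2) (Fin 2) (w.1.adicCompletion L)) * Matrix.diagonal ![1, α⁻¹] =
        ζ • (T : Matrix (Fin 2) (Fin 2) (v.adicCompletion ↥(maximalRealSubfield L))).map (toPlace v w) →
      Matrix.diagonal ![1, α] * ((Y' : GL (Fin 2) (w.1.adicCompletion L)) : Matrix (Fin 2) (Fin 2) (w.1.adicCompletion L)) * Matrix.diagonal ![1, α⁻¹] =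
        ζ • (T' : Matrix (Fin 2) (Fin 2) (v.adicCompletion ↥(maximalRealSubfield L))).map (toPlace v w) →
      (∀ i k, Valued.v (((T : Matrix (Fin 2) (Fin 2) (v.adicCompletion ↥(maximalRealSubfield L))) - 1) i k) ≤ WithZero.exp (-((j₀ + 1 : ℕ) : ℤ))) →
      (∀ i k, Valued.v (((T' : Matrix (Fin 2) (Fin 2) (v.adicCompletion ↥(maximalRealSubfield L))) - 1) i k) ≤ WithZero.exp (-((j₀ + 1 : ℕ) : ℤ))) →
      ∀ i k, Valued.v (((((Y⁻¹ * Y' : ↥(unitaryGroupOfForm (galAdicCompletionMap (L := L) (IsCMField.complexConj L) hw) (placeForm (Matrix.of fun i j : Fin 2 => if i.val + j.val + 1 = 2 then (1 : L) else 0) w.1))) :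
          GL (Fin 2) (w.1.adicCompletion L)) : Matrix (Fin 2) (Fin 2) (w.1.adicCompletion L)) - 1) i k) ≤ WithZero.exp (-(j₀ : ℤ)) := by
    intro Y Y' T T' hY hY' hT hT'
    have hq : Matrix.diagonal ![1, α] * (((Y⁻¹ * Y' : ↥(unitaryGroupOfForm (galAdicCompletionMap (L := L) (IsCMField.complexConj L) hw) (placeForm (Matrix.of fun i j : Fin 2 => if i.val + j.val + 1 = 2 then (1 : L) else 0) w.1))) :
        GL (Fin 2) (w.1.adicCompletion L)) : Matrix (Fin 2) (Fin 2) (w.1.adicCompletion L)) * Matrix.diagonal ![1, α⁻¹] =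
        ((T⁻¹ * T' : GL (Fin 2) (v.adicCompletion ↥(maximalRealSubfield L))) : Matrix (Fin 2) (Fin 2) (v.adicCompletion ↥(maximalRealSubfield L))).map (toPlace v w) := by
      rw [Subgroup.coe_mul, Subgroup.coe_inv]
      exact descent_inv_mul_eq_map (toPlace v w) hα0 hY hY'
    have hYm := eq_diagonal_inv_mul_mul_diagonal_of_descent hα0 hq
    have hTT : ∀ i k, Valued.v (((((T⁻¹ * T' : GL (Fin 2) (v.adicCompletion ↥(maximalRealSubfield L))) : Matrix (Fin 2) (Fin 2) (v.adicCompletion ↥(maximalRealSubfield L))).map (toPlace v w)) - 1) i k) ≤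
        WithZero.exp (-((j₀ + 1 : ℕ) : ℤ)) := by
      intro i k
      rw [← Matrix.map_one (toPlace v w) (map_zero _) (map_one _), ← Matrix.map_sub (toPlace v w) (map_sub (toPlace v w)), Matrix.map_apply]
      exact hι _ _ (forall_v_inv_mul_sub_one_le hlt hT hT' i k)
    intro i k
    rw [hYm]
    refine (forall_v_diagonal_twist_sub_one_le hα0 hα1 _ hTT i k).trans ?_
    calc WithZero.exp (-((j₀ + 1 : ℕ) : ℤ)) * (Valued.v α)⁻¹ ≤ WithZero.exp (-((j₀ + 1 : ℕ) : ℤ)) * WithZero.exp (1 : ℤ) := mul_le_mul_right hαinv _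
      _ = WithZero.exp (-(j₀ : ℤ)) := by rw [← WithZero.exp_add]; congr 1; push_cast; ring
  have hY : X⁻¹ * X' ∈ ψ ⁻¹' V := by
    refine hj₀ _ (hbound X X' S S' hX hX' hS hS') fun i k => ?_
    have h := hbound X' X S' S hX' hX hS' hS i k
    rw [_root_.mul_inv_rev, inv_inv]
    exact h
  -- pointwise equality of the integrands on `K × U(Φ₁)_v`
  refine setIntegral_congr_fun hKo.measurableSet fun k hk => ?_
  have hsplit : ((E₂.symm X', a) : ((cmDatum L 2 (Matrix.of fun i j : Fin 2 => if i.val + j.val + 1 = 2 then (1 : L) else 0)).Local v ×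
      (cmDatum L 1 (Matrix.of fun i j : Fin 1 => if i.val + j.val + 1 = 1 then (1 : L) else 0)).Local v)) = (E₂.symm X, a) * ψ (X⁻¹ * X') := by
    simp only [hψ, Prod.mk_mul_mk, mul_one, ← map_mul, mul_inv_cancel_left]
  show f (k⁻¹ * (E₂.symm X, a) * k) = f (k⁻¹ * (E₂.symm X', a) * k)
  rw [hsplit]
  have hgrp : k⁻¹ * ((E₂.symm X, a) * ψ (X⁻¹ * X')) * k = (k⁻¹ * (E₂.symm X, a) * k) * (k⁻¹ * ψ (X⁻¹ * X') * k) := by group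
  rw [hgrp, hfW _ _ (hconj k hk _ hY)]

include hf hα0 hvα hKo hKc in
/-- **(V-deep), SHELL-AVERAGE FORM** (the (B6-V) owner's `fbar` literal, ★ p844070 ∕ p844282): with `fbar r x := ∫_{K×U(Φ₁)} f (k⁻¹ ((E₂⁻¹ r, 1)⁻¹ x (E₂⁻¹ r, 1)) k)`,
past the depth `j` one has `fbar r x = fbar r x′` whenever `x′.2 = x.2` and the shell elements `r⁻¹ (E₂ x.1) r`, `r⁻¹ (E₂ x′.1) r` have descents `ζ·ι(S)`, `ζ·ι(S′)` with
`S ≡ 1 ≡ S′` entrywise modulo valuation `≤ exp(−j)` — at `x := ↑t`, `x′ := e ↑t` (`(e a).2 = a.2`), `r := uη⁻¹ ^ m`, `S := S_m(β_t)` normalised to `a = 1`,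
`S′ := D_{u_F} S_m(β_t) D_{u_F}⁻¹`, this is `hdeep : m + j ≤ oT t → fbar m ↑t = fbar m (e ↑t)` by (Ψ2) ★ `forall_v_shellConj_sub_smul_one_le` ∕
★ `forall_v_diagonal_conj_sub_smul_one_le`. [cite: LabesseLanglands1979, §2 (2.2) p. 9] [cite: Labesse2024StabilisationGermesSL2, Prop. 0.0.11]
[cite: Rogawski1990, §4.9 Lemma 4.9.3 p. 56] -/
theorem exists_depth_shellAverage_eq_of_descent_congr :
    ∃ j : ℕ, ∀ (r : ↥(unitaryGroupOfForm (galAdicCompletionMap (L := L) (IsCMField.complexConj L) hw) (placeForm (Matrix.of fun i j : Fin 2 => if i.val + j.val + 1 = 2 then (1 : L) else 0) w.1)))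
      (x x' : ((cmDatum L 2 (Matrix.of fun i j : Fin 2 => if i.val + j.val + 1 = 2 then (1 : L) else 0)).Local v ×
        (cmDatum L 1 (Matrix.of fun i j : Fin 1 => if i.val + j.val + 1 = 1 then (1 : L) else 0)).Local v))
      (ζ : w.1.adicCompletion L) (S S' : GL (Fin 2) (v.adicCompletion ↥(maximalRealSubfield L))),
      x'.2 = x.2 →
      Matrix.diagonal ![1, α] * (((r⁻¹ * E₂ x.1 * r : ↥(unitaryGroupOfForm (galAdicCompletionMap (L := L) (IsCMField.complexConj L) hw) (placeForm (Matrix.of fun i j : Fin 2 => if i.val + j.val + 1 = 2 then (1 : L) else 0) w.1))) :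
          GL (Fin 2) (w.1.adicCompletion L)) : Matrix (Fin 2) (Fin 2) (w.1.adicCompletion L)) * Matrix.diagonal ![1, α⁻¹] =
        ζ • (S : Matrix (Fin 2) (Fin 2) (v.adicCompletion ↥(maximalRealSubfield L))).map (toPlace v w) →
      Matrix.diagonal ![1, α] * (((r⁻¹ * E₂ x'.1 * r : ↥(unitaryGroupOfForm (galAdicCompletionMap (L := L) (IsCMField.complexConj L) hw) (placeForm (Matrix.of fun i j : Fin 2 => if i.val + j.val + 1 = 2 then (1 : L) else 0) w.1))) :
          GL (Fin 2) (w.1.adicCompletion L)) : Matrix (Fin 2) (Fin 2) (w.1.adicCompletion L)) * Matrix.diagonal ![1, α⁻¹] =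
        ζ • (S' : Matrix (Fin 2) (Fin 2) (v.adicCompletion ↥(maximalRealSubfield L))).map (toPlace v w) →
      (∀ i k, Valued.v (((S : Matrix (Fin 2) (Fin 2) (v.adicCompletion ↥(maximalRealSubfield L))) - 1) i k) ≤ WithZero.exp (-(j : ℤ))) →
      (∀ i k, Valued.v (((S' : Matrix (Fin 2) (Fin 2) (v.adicCompletion ↥(maximalRealSubfield L))) - 1) i k) ≤ WithZero.exp (-(j : ℤ))) →
        ∫ k in (((K.prod (⊤ : Subgroup ((cmDatum L 1 (Matrix.of fun i j : Fin 1 => if i.val + j.val + 1 = 1 then (1 : L) else 0)).Local v))) :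
            Subgroup ((cmDatum L 2 (Matrix.of fun i j : Fin 2 => if i.val + j.val + 1 = 2 then (1 : L) else 0)).Local v ×
              (cmDatum L 1 (Matrix.of fun i j : Fin 1 => if i.val + j.val + 1 = 1 then (1 : L) else 0)).Local v)) :
            Set ((cmDatum L 2 (Matrix.of fun i j : Fin 2 => if i.val + j.val + 1 = 2 then (1 : L) else 0)).Local v ×
              (cmDatum L 1 (Matrix.of fun i j : Fin 1 => if i.val + j.val + 1 = 1 then (1 : L) else 0)).Local v)),
            f (k⁻¹ * ((E₂.symm r, (1 : (cmDatum L 1 (Matrix.of fun i j : Fin 1 => if i.val + j.val + 1 = 1 then (1 : L) else 0)).Local v))⁻¹ * x *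
              (E₂.symm r, (1 : (cmDatum L 1 (Matrix.of fun i j : Fin 1 => if i.val + j.val + 1 = 1 then (1 : L) else 0)).Local v))) * k) ∂ν =
        ∫ k in (((K.prod (⊤ : Subgroup ((cmDatum L 1 (Matrix.of fun i j : Fin 1 => if i.val + j.val + 1 = 1 then (1 : L) else 0)).Local v))) :
            Subgroup ((cmDatum L 2 (Matrix.of fun i j : Fin 2 => if i.val + j.val + 1 = 2 then (1 : L) else 0)).Local v ×
              (cmDatum L 1 (Matrix.of fun i j : Fin 1 => if i.val + j.val + 1 = 1 then (1 : L) else 0)).Local v)) :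
            Set ((cmDatum L 2 (Matrix.of fun i j : Fin 2 => if i.val + j.val + 1 = 2 then (1 : L) else 0)).Local v ×
              (cmDatum L 1 (Matrix.of fun i j : Fin 1 => if i.val + j.val + 1 = 1 then (1 : L) else 0)).Local v)),
            f (k⁻¹ * ((E₂.symm r, (1 : (cmDatum L 1 (Matrix.of fun i j : Fin 1 => if i.val + j.val + 1 = 1 then (1 : L) else 0)).Local v))⁻¹ * x' *
              (E₂.symm r, (1 : (cmDatum L 1 (Matrix.of fun i j : Fin 1 => if i.val + j.val + 1 = 1 then (1 : L) else 0)).Local v))) * k) ∂ν := by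
  obtain ⟨j, hj⟩ := exists_depth_setIntegral_conj_prod_eq_of_descent_congr L v w hw ν f hf hα0 hvα E₂ K hKo hKc
  refine ⟨j, fun r x x' ζ S S' hx2 hX hX' hS hS' => ?_⟩
  have hx : (E₂.symm r, (1 : (cmDatum L 1 (Matrix.of fun i j : Fin 1 => if i.val + j.val + 1 = 1 then (1 : L) else 0)).Local v))⁻¹ * x *
      (E₂.symm r, (1 : (cmDatum L 1 (Matrix.of fun i j : Fin 1 => if i.val + j.val + 1 = 1 then (1 : L) else 0)).Local v)) = (E₂.symm (r⁻¹ * E₂ x.1 * r), x.2) := by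
    rw [prod_symm_conj_eq L v w hw E₂ r (E₂ x.1) x.2, ContinuousMulEquiv.symm_apply_apply]
  have hx' : (E₂.symm r, (1 : (cmDatum L 1 (Matrix.of fun i j : Fin 1 => if i.val + j.val + 1 = 1 then (1 : L) else 0)).Local v))⁻¹ * x' *
      (E₂.symm r, (1 : (cmDatum L 1 (Matrix.of fun i j : Fin 1 => if i.val + j.val + 1 = 1 then (1 : L) else 0)).Local v)) = (E₂.symm (r⁻¹ * E₂ x'.1 * r), x.2) := by
    rw [prod_symm_conj_eq L v w hw E₂ r (E₂ x'.1) x.2, ContinuousMulEquiv.symm_apply_apply, ← hx2]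
  simp_rw [hx, hx']
  exact hj _ _ ζ S S' hX hX' hS hS' x.2

end Deep

end Literature.NumberTheory.Rogawski1990

end
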